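import Summits.AtomisticToContinuum.BoseEinsteinCondensation.Theorems.BECThomsonPrincipleGDTransferSeededGradingDefs
import Summits.AtomisticToContinuum.BoseEinsteinCondensation.Theorems.BECThomsonPrincipleGDTransferSeededCountLaw
import Summits.AtomisticToContinuum.BoseEinsteinCondensation.Theorems.BECThomsonPrincipleGDTransferSeededIvtGlue
import Summits.AtomisticToContinuum.BoseEinsteinCondensation.Theorems.BECThomsonPrincipleGDTransferSeededFreeCorner
import Summits.AtomisticToContinuum.BoseEinsteinCondensation.Theorems.BECThomsonPrincipleGDTransferSeededLocalConstancy

/-!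
# Route `BECThomsonPrinciple`, crux `GDTransfer` (stmt-AtomisticToContinuum-9482), line `seeded-continuity` —
# fixed-`N` seed programme: THE FIXED-`N` SEED (registered sub-goal `fixedN_noBalancedCat`)

Supports (does not close) stmt-AtomisticToContinuum-9482.

**Statement** (`fixedN_noBalancedCat : PointwiseCatExclusion → (CountLaw → ∀ v adm finite-continuous, LawLocalConstancy v)
→ FixedNNoBalancedCat`, typed in `…SeededGradingDefs`): for an admissible finite continuous profile and band parameters
`θ, β` there is `N₀` such that for every `N ≥ N₀` and every `L_min > 0` ONE threshold `τ < 1/2` — chosen after `N`, before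
`L` — excludes balanced cats (`¬(τ ≤ P(n̂₀ < θN) ∧ τ ≤ P(n̂₀ ≥ (1−β)N))`) among the small-slack near-minimisers at EVERY
side `L ≥ L_min`.  This is the seed `NoBalancedCat` of the line with the order of `∃ τ` and `∀ N` exchanged: what remains
open of the seed is the uniformity of `τ` in `N`.

**Proof.** Pointwise exclusion gives `τ_L < 1/2` at each side; local constancy of the depleted-side and condensed-side
masses (hypothesis, at tolerance `(1/2 − τ_L)/2`) spreads it to a ball around `L` with threshold `(1/2 + τ_L)/2`, because a
balanced near-minimiser nearby would force a `τ_L`-balanced near-minimiser at `L` (near-minimisers exist, `exists_nearMin`);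
a finite subcover of the compact stretch `[L_min, max L_min (A·N)]` gives `τ = max(1/4, max_i (1/2 + τ_{L_i})/2) < 1/2`;
beyond `A·N` the free corner (`stub_freeCorner`, tolerance `(1−θ)/8`) and Markov (`mean_add_le`) give `P(n̂₀ < θN) ≤ 1/8 < τ`.

References: LSSY2005 §1.2, Ch. 5 (footnote to (5.3)); ReedSimonIV1978 §XIII.12.
-/

noncomputable section

open MeasureTheory Filter Set Metric
open scoped ENNReal NNReal

namespace Summit.AtomisticToContinuum.BoseEinsteinCondensation.Cruxes.GDTransfer.Seeded

open Literature.MathematicalPhysics.QuantumManyBody.BoseGas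

variable {m : ℕ}


/-! ## Bookkeeping -/

/-- From `ofReal a ≤ x` with `x` finite, `a ≤ x.toReal`. -/
theorem le_toReal_of_ofReal_le {a : ℝ} {x : ℝ≥0∞} (hx : x ≠ ⊤) (h : ENNReal.ofReal a ≤ x) : a ≤ x.toReal := by
  rcases le_or_gt 0 a with ha | ha
  · exact (ENNReal.ofReal_le_iff_le_toReal hx).1 h
  · exact ha.le.trans ENNReal.toReal_nonneg

/-- A larger threshold excludes at least as much. -/
theorem not_balanced_mono {τ τ' : ℝ} (h : τ' ≤ τ) {p q : ℝ≥0∞}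
    (hex : ¬ (ENNReal.ofReal τ' ≤ p ∧ ENNReal.ofReal τ' ≤ q)) : ¬ (ENNReal.ofReal τ ≤ p ∧ ENNReal.ofReal τ ≤ q) :=
  fun hh => hex ⟨(ENNReal.ofReal_le_ofReal h).trans hh.1, (ENNReal.ofReal_le_ofReal h).trans hh.2⟩

/-- **The free corner excludes the depleted side**: if `N ≤ ⟨n̂₀⟩ + εN` with `ε = (1 − θ)/8`, then
`P(n̂₀ < θN) ≤ 1/8` (Markov through `mean_add_le`). -/
theorem loMass_le_of_corner {L : ℝ} (hL : 0 < L) (Ψ : PeriodicTrialState (m + 1) L) {θ : ℝ} (hθ1 : θ < 1)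
    (h : ((m + 1 : ℕ) : ℝ≥0∞) ≤ condensateOccupation (m + 1) L Ψ.ψ + ENNReal.ofReal ((1 - θ) / 8 * (m + 1))) :
    loMass m L θ Ψ.ψ ≤ ENNReal.ofReal (1 / 8) := by
  classical
  have hC : CountLaw := stub_countLaw
  have hmean := mean_add_le hC hL Ψ (β := 1 - θ) (by linarith)
  have hlo : loMass m L θ Ψ.ψ = lawMass m L (fun j => ¬ ((1 - (1 - θ)) * (m + 1) ≤ (j : ℝ))) Ψ.ψ := by
    unfold loMass lawMass
    refine Finset.sum_congr (Finset.filter_congr fun S _ => ?_) fun _ _ => rfl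
    simp only [sub_sub_cancel, not_le]
  rw [← hlo] at hmean
  set a : ℝ≥0∞ := ENNReal.ofReal ((1 - θ) * (m + 1)) with ha
  have hN0 : (0 : ℝ) < m + 1 := by positivity
  have ha0 : a ≠ 0 := (ENNReal.ofReal_pos.2 (by nlinarith)).ne'
  have hocc_top : condensateOccupation (m + 1) L Ψ.ψ ≠ ⊤ :=
    ne_top_of_le_ne_top (ENNReal.natCast_ne_top _) (le_trans (le_add_right le_rfl) hmean)
  have h1 : condensateOccupation (m + 1) L Ψ.ψ + a * loMass m L θ Ψ.ψ ≤
      condensateOccupation (m + 1) L Ψ.ψ + ENNReal.ofReal ((1 - θ) / 8 * (m + 1)) := hmean.trans h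
  rw [add_comm (condensateOccupation _ _ _), add_comm (condensateOccupation _ _ _)] at h1
  have h2 : a * loMass m L θ Ψ.ψ ≤ ENNReal.ofReal ((1 - θ) / 8 * (m + 1)) :=
    ENNReal.le_of_add_le_add_right hocc_top h1
  have h3 : loMass m L θ Ψ.ψ ≤ ENNReal.ofReal ((1 - θ) / 8 * (m + 1)) / a := by
    rw [ENNReal.le_div_iff_mul_le (Or.inl ha0) (Or.inl ENNReal.ofReal_ne_top), mul_comm]
    exact h2
  refine h3.trans (le_of_eq ?_)
  rw [ha, ← ENNReal.ofReal_div_of_pos (by nlinarith)]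
  congr 1
  have h1θ : (1 - θ) ≠ 0 := (by linarith : (0 : ℝ) < 1 - θ).ne'
  field_simp

/-! ## The registered sub-goal -/

/-- **Registered sub-goal `fixedN_noBalancedCat` of the fixed-`N` seed programme** (line `seeded-continuity`, crux
`GDTransfer`, stmt-AtomisticToContinuum-9482): the seed `NoBalancedCat` with the threshold chosen AFTER the particle
number — pointwise exclusion spread by local constancy of the law, a finite subcover of the compact stretch of sides, and
the free corner.  [cite: LSSY2005, Ch. 5 footnote to (5.3)] -/
theorem fixedN_noBalancedCat : PointwiseCatExclusion → (CountLaw → ∀ v : ℝ → ENNReal, Literature.MathematicalPhysics.QuantumManyBody.BoseGas.IsRepulsiveFiniteRange v → IsFiniteContinuous v → LawLocalConstancy v) → FixedNNoBalancedCat := by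
  intro hP hLC v hv hfc θ β hθ hβ hθβ
  classical
  have hC : CountLaw := stub_countLaw
  have hLaw := hLC hC v hv hfc
  have hθ1 : θ < 1 := by linarith
  -- pointwise exclusion and the free corner
  obtain ⟨N₁, hN₁⟩ := hP v hv hfc θ β hθ hβ hθβ
  obtain ⟨A, hA, N₂, hN₂⟩ := stub_freeCorner v hv ((1 - θ) / 8) (by linarith)
  refine ⟨max N₁ N₂, fun m hm Lmin hLmin => ?_⟩
  have hm1 : N₁ ≤ m + 1 := (le_max_left _ _).trans hm
  have hm2 : N₂ ≤ m + 1 := (le_max_right _ _).trans hm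
  have hE0 : ∀ L : ℝ, 0 < L → periodicGroundStateEnergy v (m + 1) L ≠ ⊤ := fun L hL =>
    (stub_localConstancy hC v hv hfc m β L hL).1
  -- pointwise data `τ_L, δ_L`
  choose! τp hτp0 hτp δp hδp hexcl using hN₁ m hm1
  -- local constancy of the depleted-side and condensed-side masses at tolerance `(1/2 − τ_L)/2`
  have hlo : ∀ L : ℝ, 0 < L → ∃ r : ℝ, 0 < r ∧ ∃ δ₁ : ℝ≥0∞, 0 < δ₁ ∧ ∀ L' : ℝ, |L' - L| < r →
      ∃ δ' : ℝ≥0∞, 0 < δ' ∧ ∀ (Ψ' : PeriodicTrialState (m + 1) L') (Ψ₁ : PeriodicTrialState (m + 1) L),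
        periodicEnergy v Ψ' ≤ periodicGroundStateEnergy v (m + 1) L' + δ' →
        periodicEnergy v Ψ₁ ≤ periodicGroundStateEnergy v (m + 1) L + δ₁ →
        (loMass m L' θ Ψ'.ψ).toReal ≤ (loMass m L θ Ψ₁.ψ).toReal + (1 / 2 - τp L) / 2 ∧
          (loMass m L θ Ψ₁.ψ).toReal ≤ (loMass m L' θ Ψ'.ψ).toReal + (1 / 2 - τp L) / 2 :=
    fun L hL => hLaw m (fun j => (j : ℝ) < θ * (m + 1)) L hL _ (by linarith [hτp L hL])
  have hhi : ∀ L : ℝ, 0 < L → ∃ r : ℝ, 0 < r ∧ ∃ δ₁ : ℝ≥0∞, 0 < δ₁ ∧ ∀ L' : ℝ, |L' - L| < r →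
      ∃ δ' : ℝ≥0∞, 0 < δ' ∧ ∀ (Ψ' : PeriodicTrialState (m + 1) L') (Ψ₁ : PeriodicTrialState (m + 1) L),
        periodicEnergy v Ψ' ≤ periodicGroundStateEnergy v (m + 1) L' + δ' →
        periodicEnergy v Ψ₁ ≤ periodicGroundStateEnergy v (m + 1) L + δ₁ →
        (hiMass m L' β Ψ'.ψ).toReal ≤ (hiMass m L β Ψ₁.ψ).toReal + (1 / 2 - τp L) / 2 ∧
          (hiMass m L β Ψ₁.ψ).toReal ≤ (hiMass m L' β Ψ'.ψ).toReal + (1 / 2 - τp L) / 2 :=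
    fun L hL => hLaw m (fun j => (1 - β) * (m + 1) ≤ (j : ℝ)) L hL _ (by linarith [hτp L hL])
  choose! rlo hrlo δlo hδlo δ'lo hδ'lo Hlo using hlo
  choose! rhi hrhi δhi hδhi δ'hi hδ'hi Hhi using hhi
  -- exclusion on a neighbourhood of each side, threshold `(1/2 + τ_L)/2`
  have hnbhd : ∀ L : ℝ, 0 < L → ∀ L' : ℝ, |L' - L| < min (rlo L) (rhi L) → 0 < L' →
      ∃ δ' : ℝ≥0∞, 0 < δ' ∧ ∀ Ψ' : PeriodicTrialState (m + 1) L',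
        periodicEnergy v Ψ' ≤ periodicGroundStateEnergy v (m + 1) L' + δ' →
        ¬ (ENNReal.ofReal ((1 / 2 + τp L) / 2) ≤ loMass m L' θ Ψ'.ψ ∧
            ENNReal.ofReal ((1 / 2 + τp L) / 2) ≤ hiMass m L' β Ψ'.ψ) := by
    intro L hL L' hL' hL'0
    have hL'lo : |L' - L| < rlo L := hL'.trans_le (min_le_left _ _)
    have hL'hi : |L' - L| < rhi L := hL'.trans_le (min_le_right _ _)
    refine ⟨min (δ'lo L L') (δ'hi L L'), lt_min (hδ'lo L hL L' hL'lo) (hδ'hi L hL L' hL'hi), ?_⟩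
    rintro Ψ' hΨ' ⟨h1, h2⟩
    -- a near-minimiser at `L` with all three slacks
    set δ₀ : ℝ≥0∞ := min (min (δlo L) (δhi L)) (δp L) with hδ₀
    have hδ₀0 : 0 < δ₀ := lt_min (lt_min (hδlo L hL) (hδhi L hL)) (hδp L hL)
    obtain ⟨Ψ₁, hΨ₁⟩ := exists_nearMin (hE0 L hL) hδ₀0
    have hΨ₁lo : periodicEnergy v Ψ₁ ≤ periodicGroundStateEnergy v (m + 1) L + δlo L :=
      hΨ₁.trans (add_le_add le_rfl ((min_le_left _ _).trans (min_le_left _ _)))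
    have hΨ₁hi : periodicEnergy v Ψ₁ ≤ periodicGroundStateEnergy v (m + 1) L + δhi L :=
      hΨ₁.trans (add_le_add le_rfl ((min_le_left _ _).trans (min_le_right _ _)))
    have hΨ₁p : periodicEnergy v Ψ₁ ≤ periodicGroundStateEnergy v (m + 1) L + δp L :=
      hΨ₁.trans (add_le_add le_rfl (min_le_right _ _))
    have hΨ'lo : periodicEnergy v Ψ' ≤ periodicGroundStateEnergy v (m + 1) L' + δ'lo L L' :=
      hΨ'.trans (add_le_add le_rfl (min_le_left _ _))
    have hΨ'hi : periodicEnergy v Ψ' ≤ periodicGroundStateEnergy v (m + 1) L' + δ'hi L L' :=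
      hΨ'.trans (add_le_add le_rfl (min_le_right _ _))
    obtain ⟨hlo1, -⟩ := Hlo L hL L' hL'lo Ψ' Ψ₁ hΨ'lo hΨ₁lo
    obtain ⟨hhi1, -⟩ := Hhi L hL L' hL'hi Ψ' Ψ₁ hΨ'hi hΨ₁hi
    -- `τ_L ≤ lo(Ψ₁)` and `τ_L ≤ hi(Ψ₁)`: contradiction with pointwise exclusion at `L`
    have hlo' : (1 / 2 + τp L) / 2 ≤ (loMass m L' θ Ψ'.ψ).toReal :=
      le_toReal_of_ofReal_le (lawMass_ne_top hC hL'0 Ψ' _) h1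
    have hhi' : (1 / 2 + τp L) / 2 ≤ (hiMass m L' β Ψ'.ψ).toReal :=
      le_toReal_of_ofReal_le (lawMass_ne_top hC hL'0 Ψ' _) h2
    refine hexcl L hL Ψ₁ hΨ₁p ⟨?_, ?_⟩
    · unfold loMass at hlo1 hlo' ⊢
      rw [ENNReal.ofReal_le_iff_le_toReal (lawMass_ne_top hC hL Ψ₁ (fun j => (j : ℝ) < θ * (m + 1)))]
      linarith
    · unfold hiMass at hhi1 hhi' ⊢
      rw [ENNReal.ofReal_le_iff_le_toReal (lawMass_ne_top hC hL Ψ₁ (fun j => (1 - β) * (m + 1) ≤ (j : ℝ)))]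
      linarith
  -- finite subcover of the compact stretch `[Lmin, max Lmin (A·N)]`
  set Lmax : ℝ := max Lmin (A * (m + 1)) with hLmax
  set K : Set ℝ := Icc Lmin Lmax with hK
  have hKpos : ∀ x ∈ K, 0 < x := fun x hx => hLmin.trans_le hx.1
  have hcover : K ⊆ ⋃ x : K, ball (x : ℝ) (min (rlo x) (rhi x)) := fun y hy =>
    mem_iUnion.2 ⟨⟨y, hy⟩, mem_ball_self (lt_min (hrlo y (hKpos y hy)) (hrhi y (hKpos y hy)))⟩
  obtain ⟨t, ht⟩ := isCompact_Icc.elim_finite_subcover (fun x : K => ball (x : ℝ) (min (rlo x) (rhi x)))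
    (fun _ => isOpen_ball) hcover
  have hLminK : Lmin ∈ K := ⟨le_rfl, le_max_left _ _⟩
  have htne : t.Nonempty := by
    obtain ⟨x, hx⟩ := mem_iUnion.1 (ht hLminK)
    obtain ⟨hxt, -⟩ := mem_iUnion.1 hx
    exact ⟨x, hxt⟩
  -- the threshold
  set τ : ℝ := max (1 / 4) (t.sup' htne fun x => (1 / 2 + τp x) / 2) with hτdef
  have hτ4 : 1 / 4 ≤ τ := le_max_left _ _
  have hτlt : τ < 1 / 2 := by
    refine max_lt (by norm_num) ((Finset.sup'_lt_iff htne).2 fun x _ => ?_)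
    have := hτp x (hKpos x x.2)
    linarith
  refine ⟨τ, by linarith, hτlt, fun L hL => ?_⟩
  have hL0 : 0 < L := hLmin.trans_le hL
  by_cases hLK : L ≤ Lmax
  · -- inside the compact stretch: a ball of the subcover
    obtain ⟨x, hx⟩ := mem_iUnion.1 (ht ⟨hL, hLK⟩)
    obtain ⟨hxt, hLx⟩ := mem_iUnion.1 hx
    rw [mem_ball, Real.dist_eq] at hLx
    obtain ⟨δ', hδ', hex⟩ := hnbhd x (hKpos x x.2) L hLx hL0
    refine ⟨δ', hδ', fun Ψ hΨ => not_balanced_mono ?_ (hex Ψ hΨ)⟩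
    rw [hτdef]
    exact le_max_of_le_right (Finset.le_sup' (fun x : K => (1 / 2 + τp x) / 2) hxt)
  · -- beyond the corner: the depleted side is small
    have hAL : A * (m + 1) ≤ L := (le_max_right _ _).trans (not_le.1 hLK).le
    obtain ⟨δ, hδ, hcorner⟩ := hN₂ m hm2 L hAL
    refine ⟨δ, hδ, fun Ψ hΨ hh => ?_⟩
    have h8 := loMass_le_of_corner hL0 Ψ hθ1 (hcorner Ψ hΨ)
    have : τ ≤ 1 / 8 := (ENNReal.ofReal_le_ofReal_iff (by norm_num)).1 (hh.1.trans h8)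
    linarith

end Summit.AtomisticToContinuum.BoseEinsteinCondensation.Cruxes.GDTransfer.Seeded

end
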